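import Mathlib
import Summits.Ventures.PercRepro2.SwOutCrossJunctionSw

/-!
# An instance of Theorem A_cross: two dropped vertices joined by a cross edge (blind cell
PercRepro2, night-4 g24, 2026-08-28; proofs/NIGHT4-G24.md §8)

The graph `crossEx` on `Fin 7` (`l = 0`, `h = 1`, `o = 2`, the junction `u = 3`, the dropped
vertices `p₁ = 4`, `p₂ = 5` joined by the CROSS EDGE `p₁p₂`, the u-arm `x = 6`) with the nine
edges `hx, ux, up₁, up₂, p₁p₂, xl, p₁l, p₂l, ol`.  The several-arms hypotheses (b)/(d) of
Theorem A_sev fail at `p₁` (its neighbour `p₂` inside `U` is not adjacent to `h`, and its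
component contains the second neighbour `p₂` of `u`), the mixed single junction of Theorem A_mix
fails (two dropped vertices); the cross junction applies: **row (SW) holds** (`sw_crossEx`) by
`sw_of_crossJunction` with the cross-edge graph `⊤` on `Fin 2`.
-/

namespace Summit.Ventures.PercRepro2

namespace CrossArm

open Hull LocRows

open scoped Classical

/-- The cross junction: `l = 0`, `h = 1`, `o = 2`, `u = 3`, `p₁ = 4`, `p₂ = 5`, `x = 6`. -/
def crossEx : Fin 9 → Sym2 (Fin 7)
  | 0 => s(1, 6) | 1 => s(3, 6) | 2 => s(3, 4) | 3 => s(3, 5) | 4 => s(4, 5)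
  | 5 => s(6, 0) | 6 => s(4, 0) | 7 => s(5, 0) | 8 => s(2, 0)

/-- The two dropped vertices. -/
def crossExP : Fin 2 → Fin 7 := ![4, 5]

/-- An edge with no end at `c` is not an edge at `c`. -/
lemma crossEx_no_edge_at {a b c x : Fin 7} (h : s(a, b) = s(c, x)) (ha : a ≠ c) (hb : b ≠ c) :
    False := by
  rw [Sym2.eq_iff] at h
  rcases h with ⟨h1, _⟩ | ⟨_, h2⟩
  · exact ha h1
  · exact hb h2

/-- The other end of an edge at `a`. -/
lemma crossEx_eq_of_edge {a b x : Fin 7} (h : s(a, b) = s(a, x)) (hab : b ≠ a) : x = b := by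
  rw [Sym2.eq_iff] at h
  rcases h with ⟨_, h2⟩ | ⟨h1, h2⟩
  · exact h2.symm
  · exact absurd h2 hab

/-- The cross junction of `crossEx`. -/
theorem crossEx_junction : CrossJunction crossEx ({0}ᶜ) 1 3 crossExP (⊤ : SimpleGraph (Fin 2)) 2 where
  hne_hu := by decide
  hne_hp := by decide
  hne_up := by decide
  p_inj := by decide
  hou := by decide
  hop := by decide
  hhU := by simp
  huU := by simp
  hpU := by intro i; fin_cases i <;> simp [crossExP]
  hloop_h := by intro e; fin_cases e <;> decide
  hloop_u := by intro e; fin_cases e <;> decide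
  hnadj := by intro e; fin_cases e <;> decide
  hnadj_p := by intro i e; fin_cases i <;> fin_cases e <;> decide
  hup := by
    intro i
    fin_cases i
    · exact ⟨2, rfl⟩
    · exact ⟨3, rfl⟩
  hcross := by
    intro i j hij
    fin_cases i <;> fin_cases j
    · exact absurd hij (by decide)
    · exact ⟨4, rfl⟩
    · exact ⟨4, by decide⟩
    · exact absurd hij (by decide)
  hcross_adj := by
    intro i j e
    revert e
    fin_cases i <;> fin_cases j <;> decide
  hcross_simple := by
    intro i j e e'
    revert e e'
    fin_cases i <;> fin_cases j <;> decide
  hu_adj_h := by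
    intro e x he hx
    fin_cases e <;> simp only [crossEx] at he
    · exact (crossEx_no_edge_at he (by decide) (by decide)).elim
    · obtain rfl := crossEx_eq_of_edge he (by decide)
      exact ⟨0, by decide⟩
    · obtain rfl := crossEx_eq_of_edge he (by decide)
      exact absurd rfl (hx 0)
    · obtain rfl := crossEx_eq_of_edge he (by decide)
      exact absurd rfl (hx 1)
    all_goals exact (crossEx_no_edge_at he (by decide) (by decide)).elim
  hp_in := by
    intro i e x he hxU
    fin_cases i <;> simp only [crossExP] at he
    · fin_cases e <;> simp only [crossEx] at he
      · exact (crossEx_no_edge_at he (by decide) (by decide)).elim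
      · exact (crossEx_no_edge_at he (by decide) (by decide)).elim
      · rw [Sym2.eq_swap] at he
        obtain rfl := crossEx_eq_of_edge he (by decide)
        exact Or.inl rfl
      · exact (crossEx_no_edge_at he (by decide) (by decide)).elim
      · obtain rfl := crossEx_eq_of_edge he (by decide)
        exact Or.inr ⟨1, rfl⟩
      · exact (crossEx_no_edge_at he (by decide) (by decide)).elim
      · obtain rfl := crossEx_eq_of_edge he (by decide)
        exact absurd hxU (by simp)
      · exact (crossEx_no_edge_at he (by decide) (by decide)).elim
      · exact (crossEx_no_edge_at he (by decide) (by decide)).elim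
    · fin_cases e <;> simp only [crossEx] at he
      · exact (crossEx_no_edge_at he (by decide) (by decide)).elim
      · exact (crossEx_no_edge_at he (by decide) (by decide)).elim
      · exact (crossEx_no_edge_at he (by decide) (by decide)).elim
      · rw [Sym2.eq_swap] at he
        obtain rfl := crossEx_eq_of_edge he (by decide)
        exact Or.inl rfl
      · rw [Sym2.eq_swap] at he
        obtain rfl := crossEx_eq_of_edge he (by decide)
        exact Or.inr ⟨0, rfl⟩
      · exact (crossEx_no_edge_at he (by decide) (by decide)).elim
      · exact (crossEx_no_edge_at he (by decide) (by decide)).elim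
      · obtain rfl := crossEx_eq_of_edge he (by decide)
        exact absurd hxU (by simp)
      · exact (crossEx_no_edge_at he (by decide) (by decide)).elim
  hout := by
    intro x hx hx1 hx2 hx3
    simp only [Set.mem_compl_iff, Set.mem_singleton_iff] at hx
    fin_cases x
    · exact absurd rfl hx
    · exact absurd rfl hx1
    · exact absurd rfl hx2
    · exact absurd rfl hx3
    · exact Or.inl ⟨6, 0, rfl, by simp⟩
    · exact Or.inl ⟨7, 0, rfl, by simp⟩
    · exact Or.inl ⟨5, 0, rfl, by simp⟩

/-- **Row (SW) on a junction with two dropped vertices joined by a cross edge.** -/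
theorem sw_crossEx : Sw crossEx 0 1 2 :=
  sw_of_crossJunction (by decide) crossEx_junction SimpleGraph.connected_top

end CrossArm

end Summit.Ventures.PercRepro2
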